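import Mathlib
import HarnessLib

/-!
# Crux `WazewskiBlock.UniformGalerkinTrap` (stmt-AnomalousDissipation-10352), line `SketchIdeator5`:
# stub `stub_calibration` — Mañé's calibration (coboundary) lemma, semiflow / invariant-measure form

Let `φ` be a measurable semiflow on a measurable space `X` (`φ 0 = id`, `φ (s + t) = φ s ∘ φ t` for
`s, t ≥ 0`, each `φ t` measurable), `μ` a `φ`-invariant probability measure, and `W : X → ℝ` a bounded
measurable observable whose values along every forward orbit `t ↦ W (φ t x)` are continuous on `[0, ∞)`.
If `∫ W dμ = β` and the cumulative EXCESS of `W` above `β` along `μ`-a.e. orbit is bounded,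
`∫₀ᵗ W (φ τ x) dτ ≤ β t + C` for all `t ≥ 0`, then `μ`-a.e. orbit is CALIBRATED: on every window
`β (t - s) - C ≤ ∫ₛᵗ W (φ τ x) dτ` (`0 ≤ s ≤ t`).

Proof (Mañé 1996; Lopes–Thieullen 2005, Thm. 1; Jenkinson 2006, Prop. 2.1–2.2 — the sub-action on the
support of a maximizing measure): with `I t x := ∫₀ᵗ W (φ τ x) dτ`, the function
`V x := sup_{q ∈ ℚ, q ≥ 0} (I q x - β q)` is measurable, `0 ≤ V`, and `V ≤ C` a.e.; along good orbits it is
a sub-action, `I t x - β t + V (φ t x) ≤ V x` (`t ≥ 0`); the nonnegative defect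
`β t + V - V ∘ φ t - I t` has integral `0` by invariance (`∫ V ∘ φ t = ∫ V`) and Fubini
(`∫ I t dμ = t β`), hence vanishes a.e.; so a.e. `I q x = β q + V x - V (φ q x)` for all rational
`q ≥ 0`, whence `∫ₚ^q W ∘ φ = β (q - p) + V (φ p x) - V (φ q x) ≥ β (q - p) - C`, and the real case
follows from the `B`-Lipschitz continuity of `t ↦ I t x` (`|W| ≤ B`).

* `stub_calibration` — the registered stub (last theorem), preceded by its lemmas.
-/

noncomputable section

-- `Summit.<Summit>.<Problem>` is the tree's mandated summit-side namespace (CONVENTIONS §2); deliberate duplicate.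
set_option linter.dupNamespace false

namespace Summit.AnomalousDissipation.AnomalousDissipation.Theorems.UniformGalerkinTrap.Mane

open MeasureTheory Set Filter Topology Function

section Calibration

variable {X : Type*} [MeasurableSpace X] {φ : ℝ → X → X} {W : X → ℝ} {B : ℝ}

omit [MeasurableSpace X] in
/-- Along an orbit whose observable is continuous on `[0, ∞)`, the observable is interval integrable
between nonnegative times. [folklore] -/
theorem path_intervalIntegrable {x : X} (hWc : ContinuousOn (fun t => W (φ t x)) (Ici 0)) {a b : ℝ}
    (ha : 0 ≤ a) (hb : 0 ≤ b) : IntervalIntegrable (fun τ => W (φ τ x)) volume a b :=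
  (hWc.mono fun _ hτ => (le_inf ha hb).trans hτ.1).intervalIntegrable

omit [MeasurableSpace X] in
/-- A bounded observable has path integrals Lipschitz in the endpoint: `|∫ₐᵇ W ∘ φ| ≤ B |b - a|`. [folklore] -/
theorem abs_path_integral_le {x : X} (hWb : ∀ y, |W y| ≤ B) (a b : ℝ) :
    |∫ τ in a..b, W (φ τ x)| ≤ B * |b - a| := by
  have h := intervalIntegral.norm_integral_le_of_norm_le_const (a := a) (b := b) (C := B)
    (f := fun τ => W (φ τ x)) fun τ _ => by rw [Real.norm_eq_abs]; exact hWb _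
  rwa [Real.norm_eq_abs] at h

omit [MeasurableSpace X] in
/-- **Cocycle property of the path integral**: `∫₀^{t+q} W ∘ φ_· x = ∫₀ᵗ W ∘ φ_· x + ∫₀^q W ∘ φ_· (φ t x)`
for `t, q ≥ 0` (semigroup law and translation invariance of Lebesgue measure). [folklore] -/
theorem path_integral_add {x : X} (hsemi : ∀ s t : ℝ, 0 ≤ s → 0 ≤ t → ∀ x, φ (s + t) x = φ s (φ t x))
    (hWc : ∀ x, ContinuousOn (fun t => W (φ t x)) (Ici 0)) {t q : ℝ} (ht : 0 ≤ t) (hq : 0 ≤ q) :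
    ∫ τ in (0 : ℝ)..(t + q), W (φ τ x) =
      (∫ τ in (0 : ℝ)..t, W (φ τ x)) + ∫ τ in (0 : ℝ)..q, W (φ τ (φ t x)) := by
  have h1 : (∫ τ in (0 : ℝ)..t, W (φ τ x)) + ∫ τ in t..(t + q), W (φ τ x) =
      ∫ τ in (0 : ℝ)..(t + q), W (φ τ x) :=
    intervalIntegral.integral_add_adjacent_intervals (path_intervalIntegrable (hWc x) le_rfl ht)
      (path_intervalIntegrable (hWc x) ht (by linarith))
  rw [← h1]
  congr 1
  have h2 : ∫ σ in (0 : ℝ)..q, W (φ (σ + t) x) = ∫ τ in (0 + t)..(q + t), W (φ τ x) :=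
    intervalIntegral.integral_comp_add_right (fun τ => W (φ τ x)) t
  rw [zero_add, add_comm q t] at h2
  rw [← h2]
  refine intervalIntegral.integral_congr fun σ hσ => ?_
  rw [uIcc_of_le hq] at hσ
  show W (φ (σ + t) x) = W (φ σ (φ t x))
  rw [hsemi σ t hσ.1 ht]

/-- Joint measurability of `(x, τ) ↦ W (φ (max τ 0) x)`: continuous in `τ` (orbit continuity on
`[0, ∞)` composed with `τ ↦ max τ 0`) and measurable in `x` at each time. [folklore] -/
theorem measurable_path_uncurry (hmeas : ∀ t : ℝ, 0 ≤ t → Measurable (φ t)) (hWm : Measurable W)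
    (hWc : ∀ x, ContinuousOn (fun t => W (φ t x)) (Ici 0)) :
    Measurable (fun p : X × ℝ => W (φ (max p.2 0) p.1)) := by
  have h := stronglyMeasurable_uncurry_of_continuous_of_stronglyMeasurable (ι := ℝ)
    (u := fun τ x => W (φ (max τ 0) x)) (fun x => ?_) (fun τ => ?_)
  · exact h.measurable.comp measurable_swap
  · exact (hWc x).comp_continuous (continuous_id.max continuous_const) fun τ =>
      Set.mem_Ici.2 (le_max_right _ _)
  · exact (hWm.comp (hmeas _ (le_max_right _ _))).stronglyMeasurable

omit [MeasurableSpace X] in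
/-- The path integral over `[0, t]` as a set integral of the jointly measurable integrand. [folklore] -/
theorem path_integral_eq_setIntegral {x : X} {t : ℝ} (ht : 0 ≤ t) :
    ∫ τ in (0 : ℝ)..t, W (φ τ x) = ∫ τ in Ioc 0 t, W (φ (max τ 0) x) := by
  rw [intervalIntegral.integral_of_le ht]
  refine setIntegral_congr_fun measurableSet_Ioc fun τ hτ => ?_
  show W (φ τ x) = W (φ (max τ 0) x)
  rw [max_eq_left hτ.1.le]

/-- The path integral `x ↦ ∫₀ᵗ W (φ τ x) dτ` is measurable (`t ≥ 0`). [folklore] -/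
theorem measurable_path_integral (hmeas : ∀ t : ℝ, 0 ≤ t → Measurable (φ t)) (hWm : Measurable W)
    (hWc : ∀ x, ContinuousOn (fun t => W (φ t x)) (Ici 0)) {t : ℝ} (ht : 0 ≤ t) :
    Measurable (fun x => ∫ τ in (0 : ℝ)..t, W (φ τ x)) := by
  have h : (fun x => ∫ τ in (0 : ℝ)..t, W (φ τ x)) = fun x => ∫ τ in Ioc 0 t, W (φ (max τ 0) x) :=
    funext fun x => path_integral_eq_setIntegral ht
  rw [h]
  exact ((measurable_path_uncurry hmeas hWm hWc).stronglyMeasurable.integral_prod_right'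
    (ν := volume.restrict (Ioc (0 : ℝ) t))).measurable

/-- **Fubini + invariance**: `∫ (∫₀ᵗ W (φ τ x) dτ) dμ(x) = t β` for an invariant probability measure
with `∫ W dμ = β` (`t ≥ 0`). [folklore] -/
theorem integral_path_integral {μ : Measure X} [IsProbabilityMeasure μ]
    (hmeas : ∀ t : ℝ, 0 ≤ t → Measurable (φ t)) (hinv : ∀ t : ℝ, 0 ≤ t → μ.map (φ t) = μ)
    (hWm : Measurable W) (hWb : ∀ y, |W y| ≤ B)
    (hWc : ∀ x, ContinuousOn (fun t => W (φ t x)) (Ici 0)) {β : ℝ} (hmean : ∫ x, W x ∂μ = β)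
    {t : ℝ} (ht : 0 ≤ t) :
    ∫ x, (∫ τ in (0 : ℝ)..t, W (φ τ x)) ∂μ = t * β := by
  have h : (fun x => ∫ τ in (0 : ℝ)..t, W (φ τ x)) = fun x => ∫ τ in Ioc 0 t, W (φ (max τ 0) x) :=
    funext fun x => path_integral_eq_setIntegral ht
  rw [h]
  have hF := measurable_path_uncurry hmeas hWm hWc
  have hint : Integrable (uncurry fun (x : X) (τ : ℝ) => W (φ (max τ 0) x))
      (μ.prod (volume.restrict (Ioc (0 : ℝ) t))) := by
    refine (integrable_const B).mono' hF.aestronglyMeasurable (ae_of_all _ fun p => ?_)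
    rw [Real.norm_eq_abs]
    exact hWb _
  rw [integral_integral_swap hint]
  have hinner : EqOn (fun τ => ∫ x, W (φ (max τ 0) x) ∂μ) (fun _ => β) (Ioc (0 : ℝ) t) := by
    intro τ hτ
    show ∫ x, W (φ (max τ 0) x) ∂μ = β
    rw [max_eq_left hτ.1.le]
    have h1 := integral_map (hmeas τ hτ.1.le).aemeasurable (hWm.aestronglyMeasurable (μ := μ.map (φ τ)))
    rw [hinv τ hτ.1.le] at h1
    rw [← h1, hmean]
  rw [setIntegral_congr_fun measurableSet_Ioc hinner, setIntegral_const, Real.volume_real_Ioc_of_le ht,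
    sub_zero, smul_eq_mul]

end Calibration

/-- **Mañé's calibration lemma (registered stub `stub_calibration`).** See the module docstring.
[cite: Jenkinson2006, Prop. 2.1–2.2] -/
theorem stub_calibration :
    ∀ {X : Type*} [MeasurableSpace X] (φ : ℝ → X → X) (μ : Measure X) [IsProbabilityMeasure μ]
      (W : X → ℝ) (β C : ℝ),
      (∀ t : ℝ, 0 ≤ t → Measurable (φ t)) → (∀ x, φ 0 x = x) →
      (∀ s t : ℝ, 0 ≤ s → 0 ≤ t → ∀ x, φ (s + t) x = φ s (φ t x)) →
      (∀ t : ℝ, 0 ≤ t → μ.map (φ t) = μ) →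
      Measurable W → (∃ B : ℝ, ∀ x, |W x| ≤ B) →
      (∀ x, ContinuousOn (fun t => W (φ t x)) (Set.Ici 0)) →
      ∫ x, W x ∂μ = β →
      (∀ᵐ x ∂μ, ∀ t : ℝ, 0 ≤ t → ∫ τ in (0 : ℝ)..t, W (φ τ x) ≤ β * t + C) →
      ∀ᵐ x ∂μ, ∀ s t : ℝ, 0 ≤ s → s ≤ t → β * (t - s) - C ≤ ∫ τ in s..t, W (φ τ x) := by
  intro X _ φ μ _ W β C hmeas h0 hsemi hinv hWm hWb hWc hmean hexcess
  obtain ⟨B, hB⟩ := hWb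
  -- the path integral `I t x = ∫₀ᵗ W (φ τ x) dτ`
  obtain ⟨I, hI⟩ : ∃ I : ℝ → X → ℝ, ∀ t x, I t x = ∫ τ in (0 : ℝ)..t, W (φ τ x) :=
    ⟨fun t x => ∫ τ in (0 : ℝ)..t, W (φ τ x), fun _ _ => rfl⟩
  have hI0 : ∀ x, I 0 x = 0 := fun x => by rw [hI, intervalIntegral.integral_same]
  have hIsub : ∀ x (s t : ℝ), 0 ≤ s → 0 ≤ t → I t x - I s x = ∫ τ in s..t, W (φ τ x) := by
    intro x s t hs ht
    rw [hI, hI]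
    exact intervalIntegral.integral_interval_sub_left (path_intervalIntegrable (hWc x) le_rfl ht)
      (path_intervalIntegrable (hWc x) le_rfl hs)
  have hIlip : ∀ x (s t : ℝ), 0 ≤ s → 0 ≤ t → |I t x - I s x| ≤ B * |t - s| := by
    intro x s t hs ht
    rw [hIsub x s t hs ht]
    exact abs_path_integral_le hB s t
  have hIadd : ∀ x (t q : ℝ), 0 ≤ t → 0 ≤ q → I (t + q) x = I t x + I q (φ t x) := by
    intro x t q ht hq
    rw [hI, hI, hI]
    exact path_integral_add hsemi hWc ht hq
  have hImeas : ∀ t : ℝ, 0 ≤ t → Measurable (I t) := by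
    intro t ht
    have : I t = fun x => ∫ τ in (0 : ℝ)..t, W (φ τ x) := funext fun x => hI t x
    rw [this]
    exact measurable_path_integral hmeas hWm hWc ht
  have hIμ : ∀ t : ℝ, 0 ≤ t → ∫ x, I t x ∂μ = t * β := by
    intro t ht
    have : I t = fun x => ∫ τ in (0 : ℝ)..t, W (φ τ x) := funext fun x => hI t x
    rw [this]
    exact integral_path_integral hmeas hinv hWm hB hWc hmean ht
  -- the sub-action `V x = sup_{q ∈ ℚ≥0} (I q x - β q)`
  obtain ⟨V, hV⟩ : ∃ V : X → ℝ, ∀ x, V x = ⨆ q : {q : ℚ // 0 ≤ q}, (I q.1 x - β * q.1) :=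
    ⟨fun x => ⨆ q : {q : ℚ // 0 ≤ q}, (I q.1 x - β * q.1), fun _ => rfl⟩
  have hQ0 : ∀ q : {q : ℚ // 0 ≤ q}, (0 : ℝ) ≤ q.1 := fun q => Rat.cast_nonneg.2 q.2
  haveI : Nonempty {q : ℚ // 0 ≤ q} := ⟨⟨0, le_rfl⟩⟩
  have hVmeas : Measurable V := by
    have : V = fun x => ⨆ q : {q : ℚ // 0 ≤ q}, (I q.1 x - β * q.1) := funext hV
    rw [this]
    exact Measurable.iSup fun q => (hImeas _ (hQ0 q)).sub_const _
  have hV0 : ∀ x, 0 ≤ V x := by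
    intro x
    rw [hV]
    by_cases hbdd : BddAbove (range fun q : {q : ℚ // 0 ≤ q} => I q.1 x - β * q.1)
    · have h := le_ciSup hbdd ⟨0, le_rfl⟩
      simp only [Rat.cast_zero, mul_zero, sub_zero, hI0] at h
      exact h
    · rw [ciSup_of_not_bddAbove hbdd, Real.sSup_empty]
  -- on the good set `{x | ∀ t ≥ 0, I t x ≤ β t + C}` : bounds and the sub-action inequality
  have hbdd : ∀ x, (∀ t : ℝ, 0 ≤ t → I t x ≤ β * t + C) →
      BddAbove (range fun q : {q : ℚ // 0 ≤ q} => I q.1 x - β * q.1) := by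
    intro x hx
    refine ⟨C, ?_⟩
    rintro _ ⟨q, rfl⟩
    have := hx q.1 (hQ0 q)
    simp only
    linarith
  have hVle : ∀ x, (∀ t : ℝ, 0 ≤ t → I t x ≤ β * t + C) → V x ≤ C := by
    intro x hx
    rw [hV]
    refine ciSup_le fun q => ?_
    have := hx q.1 (hQ0 q)
    linarith
  have hleV : ∀ x, (∀ t : ℝ, 0 ≤ t → I t x ≤ β * t + C) → ∀ s : ℝ, 0 ≤ s → I s x - β * s ≤ V x := by
    intro x hx s hs
    have hB0 : 0 ≤ B := (abs_nonneg _).trans (hB (φ 0 x))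
    refine le_of_forall_pos_le_add fun ε hε => ?_
    -- a rational time `q ∈ (s, s + δ)`
    set δ : ℝ := ε / (B + |β| + 1) with hδ
    have hδpos : 0 < δ := div_pos hε (by positivity)
    obtain ⟨q, hsq, hqs⟩ := exists_rat_btwn (show s < s + δ by linarith)
    have hq0 : (0 : ℚ) ≤ q := by exact_mod_cast hs.trans hsq.le
    have hqV : I q x - β * q ≤ V x := by
      rw [hV]
      exact le_ciSup (hbdd x hx) ⟨q, hq0⟩
    have hqs' : |(q : ℝ) - s| ≤ δ := by rw [abs_of_nonneg (by linarith)]; linarith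
    have h1 : |I q x - I s x| ≤ B * |(q : ℝ) - s| := hIlip x s q hs (hs.trans hsq.le)
    have h2 : |I q x - I s x| ≤ B * δ := h1.trans (mul_le_mul_of_nonneg_left hqs' hB0)
    have h3 : |β * ((q : ℝ) - s)| ≤ |β| * δ := by
      rw [abs_mul]; exact mul_le_mul_of_nonneg_left hqs' (abs_nonneg _)
    have h4 : (B + |β|) * δ ≤ ε := by
      rw [hδ, ← mul_div_assoc, div_le_iff₀ (by positivity)]
      nlinarith [abs_nonneg β]
    have h5 := (abs_le.1 h2).1
    have h6 := (abs_le.1 h3).2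
    nlinarith [h5, h6, h4, hqV, abs_nonneg β]
  have hsub : ∀ x, (∀ t : ℝ, 0 ≤ t → I t x ≤ β * t + C) → ∀ t : ℝ, 0 ≤ t →
      I t x - β * t + V (φ t x) ≤ V x := by
    intro x hx t ht
    have hVφ : V (φ t x) ≤ V x - (I t x - β * t) := by
      rw [hV (φ t x)]
      refine ciSup_le fun q => ?_
      have h1 : I q.1 (φ t x) = I (t + q.1) x - I t x := by
        have := hIadd x t q.1 ht (hQ0 q); linarith
      have h2 := hleV x hx (t + q.1) (add_nonneg ht (hQ0 q))
      rw [h1]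
      linarith
    linarith
  -- integrability of `V` and of the path integral
  have hgood : ∀ᵐ x ∂μ, ∀ t : ℝ, 0 ≤ t → I t x ≤ β * t + C := by
    filter_upwards [hexcess] with x hx t ht
    rw [hI]; exact hx t ht
  have hVC : ∀ᵐ x ∂μ, V x ≤ C := hgood.mono fun x hx => hVle x hx
  have hVint : Integrable V μ := by
    refine (integrable_const C).mono' hVmeas.aestronglyMeasurable ?_
    filter_upwards [hVC] with x hx
    rw [Real.norm_eq_abs, abs_of_nonneg (hV0 x)]
    exact hx
  have hVφint : ∀ t : ℝ, 0 ≤ t → Integrable (fun x => V (φ t x)) μ := by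
    intro t ht
    have h : Integrable V (μ.map (φ t)) := by rw [hinv t ht]; exact hVint
    exact h.comp_measurable (hmeas t ht)
  have hVφμ : ∀ t : ℝ, 0 ≤ t → ∫ x, V (φ t x) ∂μ = ∫ x, V x ∂μ := by
    intro t ht
    have h1 := integral_map (hmeas t ht).aemeasurable (hVmeas.aestronglyMeasurable (μ := μ.map (φ t)))
    rw [hinv t ht] at h1
    exact h1.symm
  have hIint : ∀ t : ℝ, 0 ≤ t → Integrable (I t) μ := by
    intro t ht
    refine (integrable_const (B * |t|)).mono' (hImeas t ht).aestronglyMeasurable (ae_of_all _ fun x => ?_)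
    rw [Real.norm_eq_abs]
    have := hIlip x 0 t le_rfl ht
    rwa [hI0, sub_zero, sub_zero] at this
  -- the calibration identity at each fixed time: `I t x = β t + V x - V (φ t x)` a.e.
  have hident : ∀ t : ℝ, 0 ≤ t → ∀ᵐ x ∂μ, I t x = β * t + V x - V (φ t x) := by
    intro t ht
    have hΔ0 : 0 ≤ᵐ[μ] fun x => β * t + V x - V (φ t x) - I t x := by
      filter_upwards [hgood] with x hx
      have := hsub x hx t ht
      simp only [Pi.zero_apply]
      linarith
    have hΔint : Integrable (fun x => β * t + V x - V (φ t x) - I t x) μ :=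
      (((integrable_const _).add hVint).sub (hVφint t ht)).sub (hIint t ht)
    have hA : Integrable (fun x => β * t + V x) μ := (integrable_const _).add hVint
    have hA' : Integrable (fun x => β * t + V x - V (φ t x)) μ := hA.sub (hVφint t ht)
    have hΔ : ∫ x, (β * t + V x - V (φ t x) - I t x) ∂μ = 0 := by
      have e1 := integral_sub hA' (hIint t ht)
      have e2 := integral_sub hA (hVφint t ht)
      have e3 := integral_add (integrable_const (β * t)) hVint
      have e4 : ∫ _x, β * t ∂μ = β * t := by simp
      beta_reduce at e1 e2 e3
      rw [e1, e2, e3, e4, hVφμ t ht, hIμ t ht]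
      ring
    have h := (integral_eq_zero_iff_of_nonneg_ae hΔ0 hΔint).1 hΔ
    filter_upwards [h] with x hx
    simp only [Pi.zero_apply] at hx
    linarith
  -- all rational times at once, and `V ∘ φ q ≤ C` a.e. for all rational `q ≥ 0`
  have hall : ∀ᵐ x ∂μ, ∀ q : {q : ℚ // 0 ≤ q}, I q.1 x = β * q.1 + V x - V (φ q.1 x) :=
    ae_all_iff.2 fun q => hident q.1 (hQ0 q)
  have hVCφ : ∀ᵐ x ∂μ, ∀ q : {q : ℚ // 0 ≤ q}, V (φ q.1 x) ≤ C := by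
    refine ae_all_iff.2 fun q => ?_
    have h : ∀ᵐ y ∂(μ.map (φ q.1)), V y ≤ C := by rw [hinv q.1 (hQ0 q)]; exact hVC
    exact ae_of_ae_map (hmeas q.1 (hQ0 q)).aemeasurable h
  -- conclusion: rational windows by the identity, real windows by Lipschitz continuity of `I · x`
  filter_upwards [hall, hVCφ] with x hx hC
  have hB0 : 0 ≤ B := (abs_nonneg _).trans (hB (φ 0 x))
  have hrat : ∀ p q : {q : ℚ // 0 ≤ q}, (p.1 : ℝ) ≤ q.1 →
      β * ((q.1 : ℝ) - p.1) - C ≤ I q.1 x - I p.1 x := by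
    intro p q _
    rw [hx p, hx q]
    have h1 := hC q
    have h2 := hV0 (φ p.1 x)
    linarith
  intro s t hs hst
  rw [← hIsub x s t hs (hs.trans hst)]
  refine le_of_forall_pos_le_add fun ε hε => ?_
  set δ : ℝ := ε / (2 * B + 2 * |β| + 1) with hδ
  have hδpos : 0 < δ := div_pos hε (by positivity)
  -- rationals `q ∈ (t, t + δ)` and `p ∈ (s, min (s + δ) q)`
  obtain ⟨q, htq, hqt⟩ := exists_rat_btwn (show t < t + δ by linarith)
  obtain ⟨p, hsp, hps⟩ := exists_rat_btwn (show s < min (s + δ) q by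
    refine lt_min (by linarith) (by linarith))
  have hpq : (p : ℝ) ≤ q := (hps.trans_le (min_le_right _ _)).le
  have hpδ : (p : ℝ) < s + δ := hps.trans_le (min_le_left _ _)
  have hq0 : (0 : ℚ) ≤ q := by exact_mod_cast (hs.trans hst).trans htq.le
  have hp0 : (0 : ℚ) ≤ p := by exact_mod_cast hs.trans hsp.le
  have h1 := hrat ⟨p, hp0⟩ ⟨q, hq0⟩ hpq
  simp only at h1
  have h2 : |I q x - I t x| ≤ B * δ := by
    refine (hIlip x t q (hs.trans hst) ((hs.trans hst).trans htq.le)).trans ?_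
    refine mul_le_mul_of_nonneg_left ?_ hB0
    rw [abs_of_nonneg (by linarith)]; linarith
  have h3 : |I p x - I s x| ≤ B * δ := by
    refine (hIlip x s p hs (hs.trans hsp.le)).trans ?_
    refine mul_le_mul_of_nonneg_left ?_ hB0
    rw [abs_of_nonneg (by linarith)]; linarith
  have h4 : |β * (((q : ℝ) - p) - (t - s))| ≤ |β| * (2 * δ) := by
    rw [abs_mul]
    refine mul_le_mul_of_nonneg_left (abs_le.2 ⟨by linarith, by linarith⟩) (abs_nonneg _)
  have h5 : (2 * B + 2 * |β|) * δ ≤ ε := by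
    rw [hδ, ← mul_div_assoc, div_le_iff₀ (by positivity)]
    nlinarith [abs_nonneg β]
  have h2' := (abs_le.1 h2).2
  have h3' := (abs_le.1 h3).1
  have h4' := (abs_le.1 h4).1
  nlinarith [h1, h2', h3', h4', h5, abs_nonneg β, hB0, hδpos]

end Summit.AnomalousDissipation.AnomalousDissipation.Theorems.UniformGalerkinTrap.Mane

end
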